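import Literature.Barriers.Schanuel.NesterenkoModularScopeMultiplicity
import Mathlib.Algebra.MvPolynomial.PDeriv
import HarnessLib

/-!
# Barrier (Schanuel) `NesterenkoModularScope`: the weight grading for Nesterenko's operator `D` (LNM 1752 Ch. 10, proof of Lemma 5.2) — proofs only

`Literature/Barriers/Schanuel/NesterenkoModularScopeGradingProofs.lean` — proofs-only sibling of
`NesterenkoModularScopeMultiplicity.lean`, first half of a proof of LNM 1752 Ch. 10 Lemma 5.2
(`NesterenkoPhilippon2001_ch10_lemma_5_2`, "the only `D`-invariant principal prime ideals of
`ℂ[z, x₁, x₂, x₃]` are `(z)` and `(Δ)`") from Mahler's theorem. No new definitions.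

The printed proof (p. 162) grades `ℜ = ℂ[z, x₁, x₂, x₃]` by the weight
`φ(F) = deg_t F(z, tx₁, t²x₂, t³x₃)` and uses: (1) `D` raises the weight of a monomial in `x̄` by
exactly one, (2) `φ(DF) ≤ φ(F) + 1`, (3) `φ(FG) = φ(F) + φ(G)`; from `DA = AB` it gets `φ(B) ≤ 1`,
then `deg_z B = 0`, i.e. `B = ax₁ + b` with `a, b ∈ ℂ`, and `b = deg_z C ∈ ℤ` from the lowest
weight part `C` of `A`. We run the same argument with the single weight `𝔴 = (2, 1, 2, 3)` (`z` of
weight `2`), for which `z∂/∂z` preserves `𝔴`-homogeneity and the `x̄`-part of `D` raises the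
`𝔴`-weight by exactly one, so that one grading yields `B = b + a x₁` directly
(`eq_C_add_C_mul_X_of_ramanujanD_eq_mul`), and the lowest `𝔴`-component gives `b ∈ ℕ`
(`exists_nat_eq_of_ramanujanD_eq_mul`).

## References

* [NesterenkoPhilippon2001] LNM 1752 (2001), Ch. 10 §5, proof of Lemma 5.2 (pp. 162–163).
-/

noncomputable section

open MvPolynomial
open Literature.NumberTheory.Transcendental

namespace Literature.Barriers.Schanuel

/-! ### The weight and the explicit form of `D` -/

/-- `𝔴(d) = 2d₀ + d₁ + 2d₂ + 3d₃`. [folklore] -/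
theorem weight_nesterenkoWeight (d : Fin 4 →₀ ℕ) : Finsupp.weight (![2, 1, 2, 3] : Fin 4 → ℕ) d = 2 * d 0 + d 1 + 2 * d 2 + 3 * d 3 := by
  rw [Finsupp.weight_apply, Finsupp.sum_fintype _ _ (fun i => by simp)]
  simp only [Fin.sum_univ_four, smul_eq_mul, Matrix.cons_val_zero, Matrix.cons_val_one,
    Matrix.cons_val]
  ring

/-- `𝔴(eⱼ) = 𝔴 j`. [folklore] -/
theorem weight_nesterenkoWeight_single (j : Fin 4) : Finsupp.weight (![2, 1, 2, 3] : Fin 4 → ℕ) (Finsupp.single j 1) = (![2, 1, 2, 3] : Fin 4 → ℕ) j := by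
  rw [Finsupp.weight_single, one_smul]

/-- `wdeg φ ≤ N` iff every monomial of `φ` has weight `≤ N`. [folklore] -/
theorem weightedTotalDegree_le_iff_nesterenkoWeight {φ : MvPolynomial (Fin 4) ℂ} {N : ℕ} :
    φ.weightedTotalDegree (![2, 1, 2, 3] : Fin 4 → ℕ) ≤ N ↔ ∀ d ∈ φ.support, Finsupp.weight (![2, 1, 2, 3] : Fin 4 → ℕ) d ≤ N :=
  Finset.sup_le_iff

/-- The explicit form `D = z ∂/∂z + Σⱼ Dxⱼ · ∂/∂xⱼ`. [cite: NesterenkoPhilippon2001, Ch. 10 §5 (p. 162)] -/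
theorem ramanujanD_apply (E : MvPolynomial (Fin 4) ℂ) :
    ramanujanD E = X 0 * pderiv 0 E + ramanujanDValues 1 * pderiv 1 E +
      ramanujanDValues 2 * pderiv 2 E + ramanujanDValues 3 * pderiv 3 E := by
  set D' : Derivation ℂ (MvPolynomial (Fin 4) ℂ) (MvPolynomial (Fin 4) ℂ) :=
    (X 0 : MvPolynomial (Fin 4) ℂ) • pderiv 0 + (ramanujanDValues 1) • pderiv 1 +
      (ramanujanDValues 2) • pderiv 2 + (ramanujanDValues 3) • pderiv 3 with hD'
  have hD : ramanujanD = D' := by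
    refine MvPolynomial.derivation_ext fun j => ?_
    rw [ramanujanD_X]
    fin_cases j <;>
      simp [hD', Derivation.add_apply, Derivation.smul_apply, pderiv_X, ramanujanDValues]
  rw [hD, hD']
  simp only [Derivation.add_apply, Derivation.smul_apply, smul_eq_mul]

/-! ### Homogeneity: `xᵢ ∂/∂xᵢ` preserves the weight, `Dxⱼ · ∂/∂xⱼ` raises it by one -/

/-- An Euler operator `xᵢ ∂/∂xᵢ` preserves `𝔴`-homogeneity. [folklore] -/
theorem isWeightedHomogeneous_X_mul_pderiv {φ : MvPolynomial (Fin 4) ℂ} {n : ℕ} (i : Fin 4)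
    (hφ : IsWeightedHomogeneous (![2, 1, 2, 3] : Fin 4 → ℕ) φ n) : IsWeightedHomogeneous (![2, 1, 2, 3] : Fin 4 → ℕ) (X i * pderiv i φ) n := by
  classical
  intro d hd
  rw [coeff_X_mul'] at hd
  split_ifs at hd with hi
  · rw [coeff_pderiv] at hd
    have h := hφ (left_ne_zero_of_mul hd)
    rwa [tsub_add_cancel_of_le] at h
    exact Finsupp.single_le_iff.mpr (Nat.one_le_iff_ne_zero.mpr (Finsupp.mem_support_iff.mp hi))
  · exact absurd rfl hd

/-- `g · ∂φ/∂xⱼ` has weight `n + 1` if `g` has weight `𝔴 j + 1` and `φ` weight `n`. [folklore] -/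
theorem isWeightedHomogeneous_mul_pderiv {g φ : MvPolynomial (Fin 4) ℂ} {n k : ℕ} (j : Fin 4)
    (hg : IsWeightedHomogeneous (![2, 1, 2, 3] : Fin 4 → ℕ) g k) (hk : k = (![2, 1, 2, 3] : Fin 4 → ℕ) j + 1) (hφ : IsWeightedHomogeneous (![2, 1, 2, 3] : Fin 4 → ℕ) φ n) :
    IsWeightedHomogeneous (![2, 1, 2, 3] : Fin 4 → ℕ) (g * pderiv j φ) (n + 1) := by
  classical
  intro d hd
  rw [coeff_mul] at hd
  obtain ⟨⟨a, m⟩, ham, hne⟩ := Finset.exists_ne_zero_of_sum_ne_zero hd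
  rw [Finset.HasAntidiagonal.mem_antidiagonal] at ham
  dsimp only at hne ham
  subst hk
  have ha := hg (left_ne_zero_of_mul hne)
  have hm : coeff m (pderiv j φ) ≠ 0 := right_ne_zero_of_mul hne
  rw [coeff_pderiv] at hm
  have h2 := hφ (left_ne_zero_of_mul hm)
  rw [map_add, weight_nesterenkoWeight_single] at h2
  rw [← ham, map_add]
  omega

/-- `Dx₁ = (x₁² − x₂)/12` has weight `2`. [folklore] -/
theorem isWeightedHomogeneous_ramanujanDValues_one :
    IsWeightedHomogeneous (![2, 1, 2, 3] : Fin 4 → ℕ) (ramanujanDValues 1) 2 := by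
  have h1 : IsWeightedHomogeneous (![2, 1, 2, 3] : Fin 4 → ℕ) (X 1 ^ 2 : MvPolynomial (Fin 4) ℂ) 2 := by
    simpa using (isWeightedHomogeneous_X ℂ (![2, 1, 2, 3] : Fin 4 → ℕ) 1).pow 2
  have h2 : IsWeightedHomogeneous (![2, 1, 2, 3] : Fin 4 → ℕ) (X 2 : MvPolynomial (Fin 4) ℂ) 2 := by
    simpa using (isWeightedHomogeneous_X ℂ (![2, 1, 2, 3] : Fin 4 → ℕ) 2)
  have h : IsWeightedHomogeneous (![2, 1, 2, 3] : Fin 4 → ℕ) (X 1 ^ 2 - X 2 : MvPolynomial (Fin 4) ℂ) 2 := by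
    rw [← mem_weightedHomogeneousSubmodule] at h1 h2 ⊢
    exact Submodule.sub_mem _ h1 h2
  simpa [ramanujanDValues] using h.C_mul (1 / 12 : ℂ)

/-- `Dx₂ = (x₁x₂ − x₃)/3` has weight `3`. [folklore] -/
theorem isWeightedHomogeneous_ramanujanDValues_two :
    IsWeightedHomogeneous (![2, 1, 2, 3] : Fin 4 → ℕ) (ramanujanDValues 2) 3 := by
  have h1 : IsWeightedHomogeneous (![2, 1, 2, 3] : Fin 4 → ℕ) (X 1 * X 2 : MvPolynomial (Fin 4) ℂ) 3 := by
    simpa using (isWeightedHomogeneous_X ℂ (![2, 1, 2, 3] : Fin 4 → ℕ) 1).mul (isWeightedHomogeneous_X ℂ (![2, 1, 2, 3] : Fin 4 → ℕ) 2)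
  have h2 : IsWeightedHomogeneous (![2, 1, 2, 3] : Fin 4 → ℕ) (X 3 : MvPolynomial (Fin 4) ℂ) 3 := by
    simpa using (isWeightedHomogeneous_X ℂ (![2, 1, 2, 3] : Fin 4 → ℕ) 3)
  have h : IsWeightedHomogeneous (![2, 1, 2, 3] : Fin 4 → ℕ) (X 1 * X 2 - X 3 : MvPolynomial (Fin 4) ℂ) 3 := by
    rw [← mem_weightedHomogeneousSubmodule] at h1 h2 ⊢
    exact Submodule.sub_mem _ h1 h2
  simpa [ramanujanDValues] using h.C_mul (1 / 3 : ℂ)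

/-- `Dx₃ = (x₁x₃ − x₂²)/2` has weight `4`. [folklore] -/
theorem isWeightedHomogeneous_ramanujanDValues_three :
    IsWeightedHomogeneous (![2, 1, 2, 3] : Fin 4 → ℕ) (ramanujanDValues 3) 4 := by
  have h1 : IsWeightedHomogeneous (![2, 1, 2, 3] : Fin 4 → ℕ) (X 1 * X 3 : MvPolynomial (Fin 4) ℂ) 4 := by
    simpa using (isWeightedHomogeneous_X ℂ (![2, 1, 2, 3] : Fin 4 → ℕ) 1).mul (isWeightedHomogeneous_X ℂ (![2, 1, 2, 3] : Fin 4 → ℕ) 3)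
  have h2 : IsWeightedHomogeneous (![2, 1, 2, 3] : Fin 4 → ℕ) (X 2 ^ 2 : MvPolynomial (Fin 4) ℂ) 4 := by
    simpa using (isWeightedHomogeneous_X ℂ (![2, 1, 2, 3] : Fin 4 → ℕ) 2).pow 2
  have h : IsWeightedHomogeneous (![2, 1, 2, 3] : Fin 4 → ℕ) (X 1 * X 3 - X 2 ^ 2 : MvPolynomial (Fin 4) ℂ) 4 := by
    rw [← mem_weightedHomogeneousSubmodule] at h1 h2 ⊢
    exact Submodule.sub_mem _ h1 h2
  simpa [ramanujanDValues] using h.C_mul (1 / 2 : ℂ)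

/-- The `x̄`-part `D − z∂/∂z` raises the weight of a `𝔴`-homogeneous polynomial by exactly one
(property 1 of the printed weight). [cite: NesterenkoPhilippon2001, Ch. 10 §5, proof of Lemma 5.2 (p. 162)] -/
theorem isWeightedHomogeneous_ramanujanD_sub {φ : MvPolynomial (Fin 4) ℂ} {n : ℕ}
    (hφ : IsWeightedHomogeneous (![2, 1, 2, 3] : Fin 4 → ℕ) φ n) :
    IsWeightedHomogeneous (![2, 1, 2, 3] : Fin 4 → ℕ) (ramanujanD φ - X 0 * pderiv 0 φ) (n + 1) := by
  have e : ramanujanD φ - X 0 * pderiv 0 φ = ramanujanDValues 1 * pderiv 1 φ +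
      ramanujanDValues 2 * pderiv 2 φ + ramanujanDValues 3 * pderiv 3 φ := by
    rw [ramanujanD_apply]; ring
  rw [e]
  exact ((isWeightedHomogeneous_mul_pderiv 1 isWeightedHomogeneous_ramanujanDValues_one
    (by simp) hφ).add (isWeightedHomogeneous_mul_pderiv 2
      isWeightedHomogeneous_ramanujanDValues_two (by simp) hφ)).add
    (isWeightedHomogeneous_mul_pderiv 3 isWeightedHomogeneous_ramanujanDValues_three (by simp) hφ)

/-! ### Degree bounds: `wdeg (DF) ≤ wdeg F + 1` (property 2) -/

/-- `wdeg (φ + ψ) ≤ max`. [folklore] -/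
theorem weightedTotalDegree_add_le_nesterenkoWeight (φ ψ : MvPolynomial (Fin 4) ℂ) :
    (φ + ψ).weightedTotalDegree (![2, 1, 2, 3] : Fin 4 → ℕ) ≤
      max (φ.weightedTotalDegree (![2, 1, 2, 3] : Fin 4 → ℕ)) (ψ.weightedTotalDegree (![2, 1, 2, 3] : Fin 4 → ℕ)) := by
  classical
  rw [weightedTotalDegree_le_iff_nesterenkoWeight]
  intro d hd
  rcases Finset.mem_union.mp (support_add hd) with h | h
  · exact (le_weightedTotalDegree _ h).trans (le_max_left _ _)
  · exact (le_weightedTotalDegree _ h).trans (le_max_right _ _)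

/-- `wdeg (xᵢ ∂φ/∂xᵢ) ≤ wdeg φ`. [folklore] -/
theorem weightedTotalDegree_X_mul_pderiv_le (i : Fin 4) (φ : MvPolynomial (Fin 4) ℂ) :
    (X i * pderiv i φ).weightedTotalDegree (![2, 1, 2, 3] : Fin 4 → ℕ) ≤ φ.weightedTotalDegree (![2, 1, 2, 3] : Fin 4 → ℕ) := by
  classical
  rw [weightedTotalDegree_le_iff_nesterenkoWeight]
  intro d hd
  rw [mem_support_iff, coeff_X_mul'] at hd
  split_ifs at hd with hi
  · rw [coeff_pderiv] at hd
    have h := le_weightedTotalDegree (![2, 1, 2, 3] : Fin 4 → ℕ) (mem_support_iff.mpr (left_ne_zero_of_mul hd))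
    rwa [tsub_add_cancel_of_le] at h
    exact Finsupp.single_le_iff.mpr (Nat.one_le_iff_ne_zero.mpr (Finsupp.mem_support_iff.mp hi))
  · exact absurd rfl hd

/-- `wdeg (g ∂φ/∂xⱼ) ≤ wdeg φ + 1` for `g` of weight `𝔴 j + 1`. [folklore] -/
theorem weightedTotalDegree_mul_pderiv_le {g : MvPolynomial (Fin 4) ℂ} {k : ℕ} (j : Fin 4)
    (hg : IsWeightedHomogeneous (![2, 1, 2, 3] : Fin 4 → ℕ) g k) (hk : k = (![2, 1, 2, 3] : Fin 4 → ℕ) j + 1) (φ : MvPolynomial (Fin 4) ℂ) :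
    (g * pderiv j φ).weightedTotalDegree (![2, 1, 2, 3] : Fin 4 → ℕ) ≤ φ.weightedTotalDegree (![2, 1, 2, 3] : Fin 4 → ℕ) + 1 := by
  classical
  rw [weightedTotalDegree_le_iff_nesterenkoWeight]
  intro d hd
  rw [mem_support_iff, coeff_mul] at hd
  obtain ⟨⟨a, m⟩, ham, hne⟩ := Finset.exists_ne_zero_of_sum_ne_zero hd
  rw [Finset.HasAntidiagonal.mem_antidiagonal] at ham
  dsimp only at hne ham
  subst hk
  have ha := hg (left_ne_zero_of_mul hne)
  have hm : coeff m (pderiv j φ) ≠ 0 := right_ne_zero_of_mul hne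
  rw [coeff_pderiv] at hm
  have h2 := le_weightedTotalDegree (![2, 1, 2, 3] : Fin 4 → ℕ) (mem_support_iff.mpr (left_ne_zero_of_mul hm))
  rw [map_add, weight_nesterenkoWeight_single] at h2
  rw [← ham, map_add]
  omega

/-- **Property 2**: `wdeg (DF) ≤ wdeg F + 1`. [cite: NesterenkoPhilippon2001, Ch. 10 §5, proof of Lemma 5.2, property 2 (p. 162)] -/
theorem weightedTotalDegree_ramanujanD_le (φ : MvPolynomial (Fin 4) ℂ) :
    (ramanujanD φ).weightedTotalDegree (![2, 1, 2, 3] : Fin 4 → ℕ) ≤ φ.weightedTotalDegree (![2, 1, 2, 3] : Fin 4 → ℕ) + 1 := by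
  rw [ramanujanD_apply]
  refine (weightedTotalDegree_add_le_nesterenkoWeight _ _).trans (max_le ?_ ?_)
  · refine (weightedTotalDegree_add_le_nesterenkoWeight _ _).trans (max_le ?_ ?_)
    · refine (weightedTotalDegree_add_le_nesterenkoWeight _ _).trans (max_le ?_ ?_)
      · exact (weightedTotalDegree_X_mul_pderiv_le 0 φ).trans (Nat.le_succ _)
      · exact weightedTotalDegree_mul_pderiv_le 1 isWeightedHomogeneous_ramanujanDValues_one
          (by simp) φ
    · exact weightedTotalDegree_mul_pderiv_le 2 isWeightedHomogeneous_ramanujanDValues_two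
        (by simp) φ
  · exact weightedTotalDegree_mul_pderiv_le 3 isWeightedHomogeneous_ramanujanDValues_three
      (by simp) φ

/-! ### Homogeneous components -/

/-- A polynomial is the sum of its `𝔴`-components of weight `≤ wdeg`. [folklore] -/
theorem sum_range_weightedHomogeneousComponent (φ : MvPolynomial (Fin 4) ℂ) :
    ∑ n ∈ Finset.range (φ.weightedTotalDegree (![2, 1, 2, 3] : Fin 4 → ℕ) + 1), weightedHomogeneousComponent (![2, 1, 2, 3] : Fin 4 → ℕ) n φ = φ := by
  classical
  ext d
  rw [coeff_sum]
  simp only [coeff_weightedHomogeneousComponent]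
  rw [Finset.sum_ite_eq]
  split_ifs with h
  · rfl
  · rw [Finset.mem_range, not_lt] at h
    symm
    by_contra hne
    have := le_weightedTotalDegree (![2, 1, 2, 3] : Fin 4 → ℕ) (mem_support_iff.mpr hne)
    omega

/-- The component of weight `N` of a sum of homogeneous polynomials. [folklore] -/
theorem weightedHomogeneousComponent_sum_of_isWeightedHomogeneous {ι : Type*} (s : Finset ι)
    (f : ι → MvPolynomial (Fin 4) ℂ) (deg : ι → ℕ)
    (h : ∀ i ∈ s, IsWeightedHomogeneous (![2, 1, 2, 3] : Fin 4 → ℕ) (f i) (deg i)) (N : ℕ) :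
    weightedHomogeneousComponent (![2, 1, 2, 3] : Fin 4 → ℕ) N (∑ i ∈ s, f i) = ∑ i ∈ s, if deg i = N then f i else 0 := by
  classical
  rw [map_sum]
  refine Finset.sum_congr rfl fun i hi => ?_
  split_ifs with hN
  · subst hN
    exact (h i hi).weightedHomogeneousComponent_same
  · exact (h i hi).weightedHomogeneousComponent_ne N (fun h' => hN h'.symm)

/-- The component of a product of homogeneous polynomials. [folklore] -/
theorem weightedHomogeneousComponent_mul_of_isWeightedHomogeneous {p q : MvPolynomial (Fin 4) ℂ}
    {m n : ℕ} (hp : IsWeightedHomogeneous (![2, 1, 2, 3] : Fin 4 → ℕ) p m) (hq : IsWeightedHomogeneous (![2, 1, 2, 3] : Fin 4 → ℕ) q n) (N : ℕ) :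
    weightedHomogeneousComponent (![2, 1, 2, 3] : Fin 4 → ℕ) N (p * q) = if m + n = N then p * q else 0 := by
  split_ifs with h
  · subst h
    exact (hp.mul hq).weightedHomogeneousComponent_same
  · exact (hp.mul hq).weightedHomogeneousComponent_ne N (fun h' => h h'.symm)

/-- The top component of a non-zero polynomial is non-zero. [folklore] -/
theorem weightedHomogeneousComponent_weightedTotalDegree_ne_zero {F : MvPolynomial (Fin 4) ℂ}
    (hF : F ≠ 0) : weightedHomogeneousComponent (![2, 1, 2, 3] : Fin 4 → ℕ) (F.weightedTotalDegree (![2, 1, 2, 3] : Fin 4 → ℕ)) F ≠ 0 := by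
  classical
  have hne : F.support.Nonempty := by
    rw [Finset.nonempty_iff_ne_empty, Ne, support_eq_empty]
    exact hF
  obtain ⟨d, hd, hdeg⟩ := Finset.exists_mem_eq_sup F.support hne (fun s => Finsupp.weight (![2, 1, 2, 3] : Fin 4 → ℕ) s)
  intro h0
  have := congrArg (coeff d) h0
  rw [coeff_weightedHomogeneousComponent, coeff_zero] at this
  rw [if_pos] at this
  · exact (mem_support_iff.mp hd) this
  · rw [weightedTotalDegree]; exact hdeg.symm

/-- **Property 3, top part**: the component of weight `wdeg F + wdeg G` of `FG` is the product
of the top components. [cite: NesterenkoPhilippon2001, Ch. 10 §5, proof of Lemma 5.2, property 3 (p. 162)] -/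
theorem weightedHomogeneousComponent_mul_top (F G : MvPolynomial (Fin 4) ℂ) :
    weightedHomogeneousComponent (![2, 1, 2, 3] : Fin 4 → ℕ) (F.weightedTotalDegree (![2, 1, 2, 3] : Fin 4 → ℕ) + G.weightedTotalDegree (![2, 1, 2, 3] : Fin 4 → ℕ)) (F * G) =
      weightedHomogeneousComponent (![2, 1, 2, 3] : Fin 4 → ℕ) (F.weightedTotalDegree (![2, 1, 2, 3] : Fin 4 → ℕ)) F *
        weightedHomogeneousComponent (![2, 1, 2, 3] : Fin 4 → ℕ) (G.weightedTotalDegree (![2, 1, 2, 3] : Fin 4 → ℕ)) G := by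
  classical
  set dF := F.weightedTotalDegree (![2, 1, 2, 3] : Fin 4 → ℕ) with hdF
  set dG := G.weightedTotalDegree (![2, 1, 2, 3] : Fin 4 → ℕ) with hdG
  conv_lhs => rw [← sum_range_weightedHomogeneousComponent F,
    ← sum_range_weightedHomogeneousComponent G, Finset.sum_mul_sum, map_sum]
  simp only [map_sum]
  rw [Finset.sum_eq_single_of_mem dF (Finset.mem_range.mpr (by omega))]
  · rw [Finset.sum_eq_single_of_mem dG (Finset.mem_range.mpr (by omega))]
    · rw [weightedHomogeneousComponent_mul_of_isWeightedHomogeneous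
        (weightedHomogeneousComponent_isWeightedHomogeneous dF F)
        (weightedHomogeneousComponent_isWeightedHomogeneous dG G), if_pos rfl]
    · intro j hj hne
      rw [weightedHomogeneousComponent_mul_of_isWeightedHomogeneous
        (weightedHomogeneousComponent_isWeightedHomogeneous dF F)
        (weightedHomogeneousComponent_isWeightedHomogeneous j G), if_neg]
      omega
  · intro i hi hne
    refine Finset.sum_eq_zero fun j hj => ?_
    rw [Finset.mem_range] at hi hj
    rw [weightedHomogeneousComponent_mul_of_isWeightedHomogeneous
      (weightedHomogeneousComponent_isWeightedHomogeneous i F)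
      (weightedHomogeneousComponent_isWeightedHomogeneous j G), if_neg]
    omega

/-! ### Step 1 of Lemma 5.2: the cofactor `B` in `DA = AB` is `b + a x₁` -/

/-- If `DA = AB` with `A ≠ 0` then `wdeg B ≤ 1` ("hence `φ(B) ≤ 1`").
[cite: NesterenkoPhilippon2001, Ch. 10 §5, proof of Lemma 5.2 (p. 162)] -/
theorem weightedTotalDegree_le_one_of_ramanujanD_eq_mul {A B : MvPolynomial (Fin 4) ℂ} (hA : A ≠ 0)
    (h : ramanujanD A = A * B) : B.weightedTotalDegree (![2, 1, 2, 3] : Fin 4 → ℕ) ≤ 1 := by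
  by_cases hB : B = 0
  · rw [hB, weightedTotalDegree_zero]; exact bot_le
  by_contra hlt
  push Not at hlt
  set N := A.weightedTotalDegree (![2, 1, 2, 3] : Fin 4 → ℕ) + B.weightedTotalDegree (![2, 1, 2, 3] : Fin 4 → ℕ) with hN
  have h1 : weightedHomogeneousComponent (![2, 1, 2, 3] : Fin 4 → ℕ) N (A * B) ≠ 0 := by
    rw [weightedHomogeneousComponent_mul_top]
    exact mul_ne_zero (weightedHomogeneousComponent_weightedTotalDegree_ne_zero hA)
      (weightedHomogeneousComponent_weightedTotalDegree_ne_zero hB)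
  have h2 : weightedHomogeneousComponent (![2, 1, 2, 3] : Fin 4 → ℕ) N (ramanujanD A) = 0 :=
    weightedHomogeneousComponent_eq_zero N _
      (lt_of_le_of_lt (weightedTotalDegree_ramanujanD_le A) (by omega))
  rw [h] at h2
  exact h1 h2

/-- A polynomial of `𝔴`-weight `≤ 1` is `b + a x₁` ("Therefore `B` does not depend on `x₂, x₃`
and is of degree less or equal to one in `x₁`"; with `z` of weight `2`, also not on `z`).
[cite: NesterenkoPhilippon2001, Ch. 10 §5, proof of Lemma 5.2 (p. 162)] -/
theorem eq_C_add_C_mul_X_of_weightedTotalDegree_le_one {B : MvPolynomial (Fin 4) ℂ}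
    (h : B.weightedTotalDegree (![2, 1, 2, 3] : Fin 4 → ℕ) ≤ 1) :
    B = C (coeff 0 B) + C (coeff (Finsupp.single 1 1) B) * X 1 := by
  classical
  have hcoeff : ∀ d : Fin 4 →₀ ℕ, d ≠ 0 → d ≠ Finsupp.single 1 1 → coeff d B = 0 := by
    intro d h0 h1
    by_contra hne
    have hw := (le_weightedTotalDegree (![2, 1, 2, 3] : Fin 4 → ℕ) (mem_support_iff.mpr hne)).trans h
    rw [weight_nesterenkoWeight] at hw
    have e0 : d 0 = 0 := by omega
    have e2 : d 2 = 0 := by omega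
    have e3 : d 3 = 0 := by omega
    have key : d = Finsupp.single 1 (d 1) := by
      ext i
      fin_cases i
      · simpa using e0
      · simp
      · simpa using e2
      · simpa using e3
    rcases Nat.le_one_iff_eq_zero_or_eq_one.mp (show d 1 ≤ 1 by omega) with h10 | h11
    · exact h0 (by rw [key, h10, Finsupp.single_zero])
    · exact h1 (by rw [key, h11])
  ext d
  rw [coeff_add, coeff_C, coeff_C_mul, coeff_X]
  by_cases h0 : d = 0
  · subst h0
    simp
  by_cases h1 : d = Finsupp.single 1 1
  · subst h1
    have : (0 : Fin 4 →₀ ℕ) ≠ Finsupp.single 1 1 := by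
      intro h'; have := congrArg (fun f => f 1) h'; simp at this
    simp [this]
  · rw [hcoeff d h0 h1, if_neg (Ne.symm h0), if_neg (Ne.symm h1)]
    simp

/-- **Step 1 of Lemma 5.2**: if `DA = AB`, `A ≠ 0`, then `B = b + a x₁` with `a, b ∈ ℂ`
(`DA = (ax₁ + b)A`, equation (74) of the printed proof).
[cite: NesterenkoPhilippon2001, Ch. 10 §5, proof of Lemma 5.2 (74) (p. 162)] -/
theorem eq_C_add_C_mul_X_of_ramanujanD_eq_mul {A B : MvPolynomial (Fin 4) ℂ} (hA : A ≠ 0)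
    (h : ramanujanD A = A * B) :
    B = C (coeff 0 B) + C (coeff (Finsupp.single 1 1) B) * X 1 :=
  eq_C_add_C_mul_X_of_weightedTotalDegree_le_one
    (weightedTotalDegree_le_one_of_ramanujanD_eq_mul hA h)

end Literature.Barriers.Schanuel

end
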